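import Summits.CriticalPhenomena.SAWScalingLimit.Theorems.SAWLoopFugacityFlowAvoidanceLimitAnchorDefs
import Literature.Analysis.Complex.Montel
import Mathlib.Analysis.SpecialFunctions.Complex.Arctan
import Mathlib.Analysis.SpecialFunctions.Complex.LogDeriv
import Mathlib.Analysis.SpecialFunctions.Pow.Deriv
import Mathlib.Analysis.Analytic.IsolatedZeros
import Mathlib.Order.Filter.AtTopBot.CountablyGenerated

/-!
# Vitali–Porter transport of the Coulomb-gas exponent to `n = 0` — stub `stub_vitaliTransport`
of line `symplectic-fermion-anchor` (crux `SAWLoopFugacityFlow.AvoidanceLimit`, stmt-CriticalPhenomena-10649)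

Pure complex analysis. A family `f_δ` (`δ ∈ (0, δ₀)`) of holomorphic functions on a preconnected
open `U ⊆ {-2 < Re z < 2}` containing the real segment `[-2 + η, 0]`, bounded by one constant `M`
on `U`, and converging pointwise on a real sub-interval `(s₁, s₂) ⊆ [-2 + η, 0]` to `d ^ bExp s`
(`d > 0`, `bExp n = 1 - (3/2π)·arctan √((2+n)/(2-n))` the Coulomb-gas boundary exponent of the
Defs file), converges at `0` to `d ^ (5/8) = d ^ bExp 0`.

Proof (Vitali–Porter): by the subsequence principle (`Filter.tendsto_of_subseq_tendsto`, `𝓝[>] 0`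
is countably generated) it suffices to extract, from every sequence `δ_k → 0+`, a subsequence
along which `f_{δ_k}(0) → d^{5/8}`. Montel's theorem (tree:
`Complex.exists_strictMono_tendstoLocallyUniformlyOn_of_norm_le`) gives a subsequence converging
locally uniformly on `U` to a holomorphic `g`; on `(s₁, s₂)` the limit is `d ^ bExp s`, which is the
restriction of the explicit holomorphic function
`h(z) = d ^ (1 - 3·arctan(((2+z)/(2-z))^{1/2}) / (2π))` (principal branches): on the strip
`(2+z)/(2-z)` avoids `(-∞, 0]`, its principal square root has positive real part, and
`Complex.arctan w = -(i/2) log((1 + wi)/(1 - wi))` is holomorphic on `{Re w > 0}` (there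
`Im ((1 + wi)/(1 - wi)) = 2 Re w / |1 - wi|² > 0`). The identity theorem
(`AnalyticOnNhd.eqOn_of_preconnected_of_frequently_eq`) on the preconnected `U` gives `g = h` on `U`,
so `g(0) = h(0) = d ^ bExp 0 = d ^ (5/8)` (`bExp_zero`).

Sources: P. Montel (1907) / J. B. Conway, *Functions of one complex variable I*, Ch. VII
Thm. 2.9 [Conway1978] (Montel, proved in the tree; the Vitali–Porter argument is its standard
corollary, ibid. Ch. VII §2); the exponent `b(n)`: J. Cardy, *SLE for theoretical physicists*,
Ann. Phys. 318 (2005) §5.3 [Cardy2005SLE]. No new definitions; the continuation `h` is written out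
explicitly in each statement.
-/

noncomputable section

open scoped BigOperators Topology symmDiff
open Filter Finset
open Literature.Probability.RandomPlanarGeometry Literature.Probability.LatticeModels

namespace Summit.CriticalPhenomena.SAWScalingLimit.Theorems.AvoidanceLimit.Anchor

/-! ## The explicit holomorphic continuation of `bExp` to the strip `-2 < Re z < 2` -/

/-- On the strip `-2 < Re z < 2` the Cayley-type quotient `(2 + z)/(2 - z)` avoids the closed
negative real axis: its imaginary part is `4 Im z / |2 - z|²`, and on the real segment `(-2, 2)` it
is a positive real. [folklore] -/
private theorem cayley_mem_slitPlane {z : ℂ} (h1 : -2 < z.re) (h2 : z.re < 2) :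
    (2 + z) / (2 - z) ∈ Complex.slitPlane := by
  by_cases him : z.im = 0
  · have hz : z = ((z.re : ℝ) : ℂ) := Complex.ext (by simp) (by simp [him])
    have hq : (2 + z) / (2 - z) = (((2 + z.re) / (2 - z.re) : ℝ) : ℂ) := by
      rw [hz]; push_cast; rfl
    rw [hq, Complex.ofReal_mem_slitPlane]
    exact div_pos (by linarith) (by linarith)
  · rw [Complex.mem_slitPlane_iff]
    right
    have hn : 0 < Complex.normSq (2 - z) := by
      rw [Complex.normSq_pos]
      intro h
      have := congrArg Complex.re h
      simp at this
      linarith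
    rw [Complex.div_im, div_sub_div_same]
    refine div_ne_zero ?_ hn.ne'
    simp only [Complex.add_im, Complex.sub_re, Complex.add_re, Complex.sub_im]
    norm_num
    intro h
    apply him
    nlinarith [h]

/-- The principal square root of a point off the closed negative real axis has positive real part
(`Re z^{1/2} = √((|z| + Re z)/2)`, Mathlib's `Complex.cpow_inv_two_re`). [folklore] -/
private theorem re_cpow_inv_two_pos {q : ℂ} (hq : q ∈ Complex.slitPlane) :
    0 < (q ^ (2⁻¹ : ℂ)).re := by
  rw [Complex.cpow_inv_two_re]
  apply Real.sqrt_pos.2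
  have : 0 < ‖q‖ + q.re := by
    rcases Complex.mem_slitPlane_iff.1 hq with h | h
    · linarith [norm_nonneg q]
    · have := Complex.abs_re_lt_norm.2 h
      linarith [neg_abs_le q.re]
  linarith

/-- `Complex.arctan w = -(i/2) log ((1 + wi)/(1 - wi))` is complex differentiable at every `w` with
`Re w > 0`: there `1 - wi ≠ 0` (imaginary part `-Re w`) and `(1 + wi)/(1 - wi)` has imaginary part
`2 Re w / |1 - wi|² > 0`, so it lies in the slit plane where the principal logarithm is holomorphic.
[folklore] -/
private theorem differentiableAt_arctan_of_re_pos {w : ℂ} (hw : 0 < w.re) :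
    DifferentiableAt ℂ Complex.arctan w := by
  have hn : 0 < Complex.normSq (1 - w * Complex.I) := by
    rw [Complex.normSq_pos]
    intro h
    have := congrArg Complex.im h
    simp at this
    linarith
  have h1 : (1 : ℂ) - w * Complex.I ≠ 0 := Complex.normSq_pos.1 hn
  have h2 : (1 + w * Complex.I) / (1 - w * Complex.I) ∈ Complex.slitPlane := by
    rw [Complex.mem_slitPlane_iff]
    right
    rw [Complex.div_im, div_sub_div_same]
    refine div_ne_zero ?_ hn.ne'
    simp only [Complex.add_im, Complex.one_im, Complex.mul_im, Complex.I_re, Complex.I_im,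
      Complex.sub_re, Complex.one_re, Complex.mul_re, Complex.add_re, Complex.sub_im]
    norm_num
    intro h
    nlinarith [h]
  change DifferentiableAt ℂ
    (fun z : ℂ => -Complex.I / 2 * Complex.log ((1 + z * Complex.I) / (1 - z * Complex.I))) w
  have hdiv : DifferentiableAt ℂ (fun z : ℂ => (1 + z * Complex.I) / (1 - z * Complex.I)) w :=
    DifferentiableAt.div (by fun_prop) (by fun_prop) h1
  have hlog : DifferentiableAt ℂ
      (fun z : ℂ => Complex.log ((1 + z * Complex.I) / (1 - z * Complex.I))) w := hdiv.clog h2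
  exact hlog.const_mul _

/-- The explicit continuation `h(z) = d ^ (1 - 3·arctan(((2+z)/(2-z))^{1/2})/(2π))` of
`s ↦ d ^ bExp s` is complex differentiable at every point of the strip `-2 < Re z < 2` (`d > 0`).
[folklore] -/
private theorem differentiableAt_continuation {d : ℝ} (hd : 0 < d) {z : ℂ} (h1 : -2 < z.re)
    (h2 : z.re < 2) :
    DifferentiableAt ℂ (fun z : ℂ => (d : ℂ) ^ ((1 : ℂ) -
      3 * Complex.arctan (((2 + z) / (2 - z)) ^ (2⁻¹ : ℂ)) / (2 * (Real.pi : ℂ)))) z := by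
  have hne : (2 : ℂ) - z ≠ 0 := by
    intro h
    have := congrArg Complex.re h
    simp at this
    linarith
  have hq : DifferentiableAt ℂ (fun z : ℂ => (2 + z) / (2 - z)) z :=
    DifferentiableAt.div (by fun_prop) (by fun_prop) hne
  have hsqrt : DifferentiableAt ℂ (fun z : ℂ => ((2 + z) / (2 - z)) ^ (2⁻¹ : ℂ)) z :=
    hq.cpow_const (cayley_mem_slitPlane h1 h2)
  have harc :=
    (differentiableAt_arctan_of_re_pos (re_cpow_inv_two_pos (cayley_mem_slitPlane h1 h2))).comp
      z hsqrt
  have hB := ((harc.const_mul 3).div_const (2 * (Real.pi : ℂ))).const_sub 1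
  exact hB.const_cpow (Or.inl (Complex.ofReal_ne_zero.2 hd.ne'))

/-- On the real segment `(-2, 2)` the continuation IS `d ^ bExp s` (real principal branches:
`Complex.ofReal_cpow`, `Real.sqrt_eq_rpow`, `Complex.ofReal_arctan`). [folklore] -/
private theorem continuation_ofReal {d : ℝ} (hd : 0 < d) {s : ℝ} (h1 : -2 < s) (h2 : s < 2) :
    (d : ℂ) ^ ((1 : ℂ) - 3 * Complex.arctan (((2 + (s : ℂ)) / (2 - (s : ℂ))) ^ (2⁻¹ : ℂ)) /
      (2 * (Real.pi : ℂ))) = ((d ^ bExp s : ℝ) : ℂ) := by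
  have hq : (0 : ℝ) ≤ (2 + s) / (2 - s) := div_nonneg (by linarith) (by linarith)
  have hsqrt : ((2 + (s : ℂ)) / (2 - (s : ℂ))) ^ (2⁻¹ : ℂ) =
      ((Real.sqrt ((2 + s) / (2 - s)) : ℝ) : ℂ) := by
    rw [Real.sqrt_eq_rpow, Complex.ofReal_cpow hq]
    push_cast
    norm_num
  rw [Complex.ofReal_cpow hd.le, hsqrt, ← Complex.ofReal_arctan]
  congr 1
  simp only [bExp]
  push_cast
  ring

/-- **Stub `stub_vitaliTransport` (S6 of line `symplectic-fermion-anchor`): Vitali–Porter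
transport of the Coulomb-gas exponent to `n = 0`.** For `0 < η < 2`, a preconnected open
`U ⊆ {-2 < Re z < 2}` containing `[-2 + η, 0]`, a family `f δ` holomorphic on `U` and bounded by
`M` there for `δ ∈ (0, δ₀)`, `d > 0` and `-2 + η ≤ s₁ < s₂ ≤ 0`: if `f δ s → d ^ bExp s` as
`δ → 0+` for every `s ∈ (s₁, s₂)`, then `f δ 0 → d ^ (5/8)`. Proof: subsequence principle +
Montel (tree) + identity theorem against the explicit continuation
`d ^ (1 - 3·arctan(((2+z)/(2-z))^{1/2})/(2π))`, and `bExp 0 = 5/8`.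
[cite: Conway1978, Ch. VII Thm. 2.9] -/
theorem stub_vitaliTransport :
    ∀ η : ℝ, 0 < η → η < 2 → ∀ (U : Set ℂ), IsOpen U → IsPreconnected U →
      U ⊆ {z : ℂ | -2 < z.re ∧ z.re < 2} → (∀ s : ℝ, s ∈ Set.Icc (-2 + η) 0 → (s : ℂ) ∈ U) →
      ∀ (f : ℝ → ℂ → ℂ) (M δ₀ : ℝ), 0 < δ₀ →
      (∀ δ ∈ Set.Ioo (0 : ℝ) δ₀, DifferentiableOn ℂ (f δ) U ∧ ∀ z ∈ U, ‖f δ z‖ ≤ M) →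
      ∀ d : ℝ, 0 < d → ∀ s₁ s₂ : ℝ, -2 + η ≤ s₁ → s₁ < s₂ → s₂ ≤ 0 →
      (∀ s ∈ Set.Ioo s₁ s₂, Tendsto (fun δ => f δ s) (𝓝[>] 0) (𝓝 ((d ^ bExp s : ℝ) : ℂ))) →
      Tendsto (fun δ => f δ 0) (𝓝[>] 0) (𝓝 ((d ^ ((5 : ℝ) / 8) : ℝ) : ℂ)) := by
  intro η hη hη2 U hUo hUc hUsub hUI f M δ₀ hδ₀ hf d hd s₁ s₂ hs₁ hs₁₂ hs₂ hlim
  -- the explicit continuation `h` of `s ↦ d ^ bExp s`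
  set h : ℂ → ℂ := fun z : ℂ => (d : ℂ) ^ ((1 : ℂ) -
    3 * Complex.arctan (((2 + z) / (2 - z)) ^ (2⁻¹ : ℂ)) / (2 * (Real.pi : ℂ))) with hh
  have hhU : DifferentiableOn ℂ h U := fun z hz =>
    (differentiableAt_continuation hd (hUsub hz).1 (hUsub hz).2).differentiableWithinAt
  have hh_real : ∀ s : ℝ, -2 < s → s < 2 → h s = ((d ^ bExp s : ℝ) : ℂ) := fun s h1 h2 =>
    continuation_ofReal hd h1 h2
  have h0U : (0 : ℂ) ∈ U := by simpa using hUI 0 ⟨by linarith, le_rfl⟩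
  have hh0 : h 0 = ((d ^ ((5 : ℝ) / 8) : ℝ) : ℂ) := by
    have := hh_real 0 (by norm_num) (by norm_num)
    rw [bExp_zero] at this
    simpa using this
  -- subsequence principle along `𝓝[>] 0`
  refine Filter.tendsto_of_subseq_tendsto fun δs hδs => ?_
  obtain ⟨N, hN⟩ : ∃ N, ∀ k ≥ N, δs k ∈ Set.Ioo 0 δ₀ :=
    eventually_atTop.1 (hδs.eventually (Ioo_mem_nhdsGT hδ₀))
  have hN' : ∀ k, δs (k + N) ∈ Set.Ioo 0 δ₀ := fun k => hN (k + N) (Nat.le_add_left N k)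
  -- Montel on the tail `k ↦ f (δs (k + N))`
  obtain ⟨g, φ, hφ, hgd, hgl, -⟩ :=
    Complex.exists_strictMono_tendstoLocallyUniformlyOn_of_norm_le hUo
      (F := fun k => f (δs (k + N))) (M := M) (fun k => (hf _ (hN' k)).1)
      (fun k z hz => (hf _ (hN' k)).2 z hz)
  have hsub : Tendsto (fun k => δs (φ k + N)) atTop (𝓝[>] 0) :=
    hδs.comp ((tendsto_add_atTop_nat N).comp hφ.tendsto_atTop)
  -- the limit is `d ^ bExp s` on `(s₁, s₂)`
  have hg_real : ∀ s ∈ Set.Ioo s₁ s₂, g s = h s := by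
    intro s hs
    have hsU : (s : ℂ) ∈ U := hUI s ⟨by linarith [hs.1], by linarith [hs.2]⟩
    have h1 : Tendsto (fun k => f (δs (φ k + N)) s) atTop (𝓝 (g s)) := hgl.tendsto_at hsU
    have h2 : Tendsto (fun k => f (δs (φ k + N)) s) atTop (𝓝 ((d ^ bExp s : ℝ) : ℂ)) :=
      (hlim s hs).comp hsub
    rw [tendsto_nhds_unique h1 h2, hh_real s (by linarith [hs.1]) (by linarith [hs.2])]
  -- identity theorem: `g = h` on `U`
  have hgh : Set.EqOn g h U := by
    have hx₀ : (s₁ + s₂) / 2 ∈ Set.Ioo s₁ s₂ := ⟨by linarith, by linarith⟩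
    have hz₀U : (((s₁ + s₂) / 2 : ℝ) : ℂ) ∈ U :=
      hUI _ ⟨by linarith [hx₀.1], by linarith [hx₀.2]⟩
    refine (hgd.analyticOnNhd hUo).eqOn_of_preconnected_of_frequently_eq (hhU.analyticOnNhd hUo)
      hUc hz₀U ?_
    have hmap : Tendsto (fun s : ℝ => (s : ℂ)) (𝓝[≠] ((s₁ + s₂) / 2))
        (𝓝[≠] (((s₁ + s₂) / 2 : ℝ) : ℂ)) :=
      Complex.continuous_ofReal.continuousWithinAt.tendsto_nhdsWithin fun s hs => by
        simpa only [Set.mem_compl_iff, Set.mem_singleton_iff, Complex.ofReal_inj] using hs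
    have hev : ∀ᶠ s : ℝ in 𝓝[≠] ((s₁ + s₂) / 2), g (s : ℂ) = h (s : ℂ) := by
      filter_upwards [mem_nhdsWithin_of_mem_nhds (Ioo_mem_nhds hx₀.1 hx₀.2)] with s hs
        using hg_real s hs
    exact hmap.frequently hev.frequently
  -- conclusion along the subsequence
  refine ⟨fun n => φ n + N, ?_⟩
  have hlim0 : Tendsto (fun k => f (δs (φ k + N)) 0) atTop (𝓝 (g 0)) := hgl.tendsto_at h0U
  rw [hgh h0U, hh0] at hlim0
  exact hlim0

end Summit.CriticalPhenomena.SAWScalingLimit.Theorems.AvoidanceLimit.Anchor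

end
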